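import Mathlib
import Summits.Ventures.PercRepro2.HCov

/-!
# Transport of the covariance form across vertex and edge types; the sum embedding
(blind cell PercRepro2, typer-1 g58)

`Gc_transport_marks` (p1 g11) carries `Gc` along a configuration map and a vertex map on ONE pair
of types. Every reduction of the weighted lane so far stays on its types (an edge becomes a loop,
a vertex becomes isolated). A reduction that ADDS an edge or a vertex — the dyadic expansions of
`GcDyadicExpand.lean`, which replace one edge of weight `s·t` (resp. `s + t − st`) by a series
(resp. parallel) pair — needs the transport ACROSS types:

* **`Types.Gc_transport`** — `Ψ : Config E' → Config E`, `φ : V → V'`, `P_q(A) = P_p(Ψ⁻¹ A)` for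
  every event, and the connectivity between the five marks carried ⟹
  `Gc q ends (marks) = Gc p ends' (φ marks)` (the proof of `Gc_transport_marks` with two pairs of
  types);
* **`Types.restrict`** `= ω ↦ ω ∘ Sum.inl` and **`prob_restrict_preimage`** — the restriction of
  the product Bernoulli law on `E ⊕ L` to `E` is the product Bernoulli law on `E`, whatever the
  weights of the spare edges (they integrate out, `sum_weight`);
* **`Types.extEnds ends loops`** — the instance on `V ⊕ W`, `E ⊕ L`: every edge of `E` carried
  by `Sum.inl`, every edge of `L` a loop, every vertex of `W` isolated; **`conn_inl_iff`** — the
  connectivity between two vertices of `V` is unchanged (a graph homomorphism one way, the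
  closure lemma `mem_of_conn_of_closed` the other);
* **`Types.Gc_embed`** — `Gc p ends (marks) = Gc (Sum.elim p r) (extEnds ends loops) (inl marks)`
  for every weight vector `r` on the spare loops: spare loops and spare isolated vertices are
  invisible to the covariance form.

Standard axioms.
-/

namespace Summit.Ventures.PercRepro2

open CovForm

namespace Types

/-! ## Transport across types -/

section Transport

variable {V V' E E' : Type*} [Fintype E] [DecidableEq E] [Fintype E'] [DecidableEq E']
  {R : Type*} [Field R]

omit [Fintype E] [DecidableEq E] [Fintype E'] [DecidableEq E'] in
/-- Preimage of a connection event between two vertices of a set `M` on which `Ψ`, `φ` transport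
connectivity. -/
lemma preimage_connEvent_of_mem {ends : E → Sym2 V} {ends' : E' → Sym2 V'}
    {Ψ : Config E' → Config E} {φ : V → V'} {M : Set V}
    (hH : ∀ ω, ∀ x ∈ M, ∀ z ∈ M, Conn ends (Ψ ω) x z ↔ Conn ends' ω (φ x) (φ z))
    {x z : V} (hx : x ∈ M) (hz : z ∈ M) :
    Ψ ⁻¹' connEvent ends x z = connEvent ends' (φ x) (φ z) := by
  ext ω
  simp [hH ω x hx z hz]

omit [Fintype E] [DecidableEq E] [Fintype E'] [DecidableEq E'] in
/-- Preimage of a one-point avoidance event between marks. -/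
lemma preimage_avoidAll_singleton_of_mem {ends : E → Sym2 V} {ends' : E' → Sym2 V'}
    {Ψ : Config E' → Config E} {φ : V → V'} {M : Set V}
    (hH : ∀ ω, ∀ x ∈ M, ∀ z ∈ M, Conn ends (Ψ ω) x z ↔ Conn ends' ω (φ x) (φ z))
    {s x : V} (hs : s ∈ M) (hx : x ∈ M) :
    Ψ ⁻¹' avoidAll ends s {x} = avoidAll ends' (φ s) {φ x} := by
  ext ω
  simp [avoidAll, hH ω s hs x hx]

omit [Fintype E] [DecidableEq E] [Fintype E'] [DecidableEq E'] in
/-- Preimage of `PDEvent` between marks. -/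
lemma preimage_PDEvent_of_mem {ends : E → Sym2 V} {ends' : E' → Sym2 V'}
    {Ψ : Config E' → Config E} {φ : V → V'} {M : Set V}
    (hH : ∀ ω, ∀ x ∈ M, ∀ z ∈ M, Conn ends (Ψ ω) x z ↔ Conn ends' ω (φ x) (φ z))
    {a₁ a₂ a₃ : V} (h1 : a₁ ∈ M) (h2 : a₂ ∈ M) (h3 : a₃ ∈ M) :
    Ψ ⁻¹' PDEvent ends a₁ a₂ a₃ = PDEvent ends' (φ a₁) (φ a₂) (φ a₃) := by
  simp only [PDEvent, Dtilde, UnionCluster.inU, Set.preimage_inter, Set.preimage_compl,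
    Set.preimage_union, preimage_connEvent_of_mem hH h1 h2, preimage_connEvent_of_mem hH h3 h1,
    preimage_connEvent_of_mem hH h3 h2]

omit [Fintype E] [DecidableEq E] [Fintype E'] [DecidableEq E'] in
/-- Preimage of `TEvent` between marks. -/
lemma preimage_TEvent_of_mem {ends : E → Sym2 V} {ends' : E' → Sym2 V'}
    {Ψ : Config E' → Config E} {φ : V → V'} {M : Set V}
    (hH : ∀ ω, ∀ x ∈ M, ∀ z ∈ M, Conn ends (Ψ ω) x z ↔ Conn ends' ω (φ x) (φ z))
    {a₁ a₂ a₃ : V} (h1 : a₁ ∈ M) (h2 : a₂ ∈ M) (h3 : a₃ ∈ M) :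
    Ψ ⁻¹' TEvent ends a₁ a₂ a₃ = TEvent ends' (φ a₁) (φ a₂) (φ a₃) := by
  simp only [TEvent, Set.preimage_inter, Set.preimage_compl, preimage_connEvent_of_mem hH h2 h1,
    preimage_connEvent_of_mem hH h2 h3]

/-- **Transport of the covariance form across types**: `P_q(A) = P_p(Ψ⁻¹ A)` for every event
`A ⊆ Config E` and `Ψ`, `φ` transport the connectivity between the five marks ⟹ `Gc` of the
instance `(q, ends)` on `(V, E)` is `Gc` of the instance `(p, ends')` on `(V', E')` at the image
marks. -/
theorem Gc_transport {q : E → R} {p : E' → R} {ends : E → Sym2 V} {ends' : E' → Sym2 V'}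
    {Ψ : Config E' → Config E} {φ : V → V'}
    (hP : ∀ A : Set (Config E), prob q A = prob p (Ψ ⁻¹' A)) (o a₁ a₂ a₃ b : V)
    (hH : ∀ ω, ∀ x ∈ ({o, a₁, a₂, a₃, b} : Set V), ∀ z ∈ ({o, a₁, a₂, a₃, b} : Set V),
      Conn ends (Ψ ω) x z ↔ Conn ends' ω (φ x) (φ z)) :
    Gc q ends o a₁ a₂ a₃ b = Gc p ends' (φ o) (φ a₁) (φ a₂) (φ a₃) (φ b) := by
  have ho : o ∈ ({o, a₁, a₂, a₃, b} : Set V) := by simp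
  have h1 : a₁ ∈ ({o, a₁, a₂, a₃, b} : Set V) := by simp
  have h2 : a₂ ∈ ({o, a₁, a₂, a₃, b} : Set V) := by simp
  have h3 : a₃ ∈ ({o, a₁, a₂, a₃, b} : Set V) := by simp
  have hb : b ∈ ({o, a₁, a₂, a₃, b} : Set V) := by simp
  simp only [Gc, DEF, EQbo, EQb3, EQb3o, EQo, EQ3, EQ3o, PDb, PDbo, Do, gap, hP,
    Set.preimage_inter, preimage_PDEvent_of_mem hH h1 h2 h3, preimage_TEvent_of_mem hH h1 h2 h3,
    preimage_TEvent_of_mem hH h2 h1 h3, preimage_connEvent_of_mem hH h1 ho,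
    preimage_connEvent_of_mem hH h2 ho, preimage_connEvent_of_mem hH h1 hb,
    preimage_connEvent_of_mem hH h2 hb, preimage_avoidAll_singleton_of_mem hH h2 h1]

end Transport

/-! ## The restriction of the product law to a summand -/

section RestrictDef

variable {E L : Type*}

/-- The restriction of a configuration on `E ⊕ L` to the edges of `E`. -/
def restrict (ω : Config (E ⊕ L)) : Config E := fun e => ω (Sum.inl e)

/-- The restriction of `Sum.elim ω η` is `ω`. -/
@[simp] lemma restrict_elim (ω : Config E) (η : Config L) : restrict (Sum.elim ω η) = ω := rfl

end RestrictDef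

section Restrict

variable {E L : Type*} [Fintype E] [DecidableEq E] [Fintype L] [DecidableEq L] {R : Type*}
  [CommRing R]

omit [DecidableEq E] [DecidableEq L] in
/-- The weight of `Sum.elim ω η` under `Sum.elim p r` is the product of the two weights. -/
lemma weight_elim (p : E → R) (r : L → R) (ω : Config E) (η : Config L) :
    weight (Sum.elim p r) (Sum.elim ω η) = weight p ω * weight r η := by
  unfold weight
  exact Fintype.prod_sum_type _

/-- **The spare edges integrate out**: the law of the restriction to `E` of the product Bernoulli
law on `E ⊕ L` with weights `Sum.elim p r` is the product Bernoulli law on `E` with weights `p`. -/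
theorem prob_restrict_preimage (p : E → R) (r : L → R) (A : Set (Config E)) :
    prob (Sum.elim p r) (restrict ⁻¹' A) = prob p A := by
  unfold prob
  rw [← (Equiv.sumArrowEquivProdArrow E L Bool).symm.sum_comp, Fintype.sum_prod_type]
  have hsym : ∀ ω : Config E, ∀ η : Config L,
      (Equiv.sumArrowEquivProdArrow E L Bool).symm (ω, η) = Sum.elim ω η := fun _ _ => rfl
  simp only [hsym]
  refine Finset.sum_congr rfl fun ω _ => ?_
  by_cases h : ω ∈ A
  · have hterm : ∀ η : Config L,
        (restrict ⁻¹' A).indicator (weight (Sum.elim p r)) (Sum.elim ω η) =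
          weight p ω * weight r η := fun η => by
      have hmem : Sum.elim ω η ∈ restrict ⁻¹' A := by simpa [Set.mem_preimage] using h
      rw [Set.indicator_of_mem hmem, weight_elim]
    simp only [hterm, ← Finset.mul_sum, sum_weight, mul_one, Set.indicator_of_mem h]
  · have hterm : ∀ η : Config L,
        (restrict ⁻¹' A).indicator (weight (Sum.elim p r)) (Sum.elim ω η) = 0 := fun η => by
      have hmem : Sum.elim ω η ∉ restrict ⁻¹' A := by simpa [Set.mem_preimage] using h
      rw [Set.indicator_of_notMem hmem]
    simp only [hterm, Finset.sum_const_zero, Set.indicator_of_notMem h]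

end Restrict

/-! ## The extended instance: spare loops and spare isolated vertices -/

section Ext

variable {V W E L : Type*}

/-- The instance on `V ⊕ W`, `E ⊕ L`: the edges of `E` carried by `Sum.inl`, the edges of `L` with
the prescribed incidences `loops` (meant to be loops). -/
def extEnds (ends : E → Sym2 V) (loops : L → Sym2 (V ⊕ W)) : E ⊕ L → Sym2 (V ⊕ W) :=
  Sum.elim (fun e => (ends e).map Sum.inl) loops

/-- `extEnds` on an edge of `E`. -/
@[simp] lemma extEnds_inl (ends : E → Sym2 V) (loops : L → Sym2 (V ⊕ W)) (e : E) :
    extEnds ends loops (Sum.inl e) = (ends e).map Sum.inl := rfl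

/-- `extEnds` on a spare edge. -/
@[simp] lemma extEnds_inr (ends : E → Sym2 V) (loops : L → Sym2 (V ⊕ W)) (l : L) :
    extEnds ends loops (Sum.inr l) = loops l := rfl

/-- The open graph of the restriction maps into the open graph of the extended instance. -/
def inlHom (ends : E → Sym2 V) (loops : L → Sym2 (V ⊕ W)) (ω : Config (E ⊕ L)) :
    openGraph ends (restrict ω) →g openGraph (extEnds ends loops) ω where
  toFun := Sum.inl
  map_rel' := by
    intro x z hxz
    rw [openGraph_adj] at hxz ⊢
    obtain ⟨hne, e, he, hends⟩ := hxz
    refine ⟨fun h => hne (Sum.inl_injective h), Sum.inl e, he, ?_⟩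
    rw [extEnds_inl, hends, Sym2.map_mk]

/-- A connection between two vertices of `V` in the restriction is a connection in the extended
instance. -/
lemma conn_inl_of_conn {ends : E → Sym2 V} {loops : L → Sym2 (V ⊕ W)} {ω : Config (E ⊕ L)}
    {x z : V} (h : Conn ends (restrict ω) x z) :
    Conn (extEnds ends loops) ω (Sum.inl x) (Sum.inl z) :=
  SimpleGraph.Reachable.map (inlHom ends loops ω) h

/-- A connection between two vertices of `V` in the extended instance (spare edges loops) is a
connection in the restriction: the closure lemma on the image of the cluster of `x`. -/
lemma conn_of_conn_inl {ends : E → Sym2 V} {loops : L → Sym2 (V ⊕ W)}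
    (hl : ∀ l, (loops l).IsDiag) {ω : Config (E ⊕ L)} {x z : V}
    (h : Conn (extEnds ends loops) ω (Sum.inl x) (Sum.inl z)) : Conn ends (restrict ω) x z := by
  have key : Sum.inl z ∈ {v : V ⊕ W | ∃ y, v = Sum.inl y ∧ Conn ends (restrict ω) x y} := by
    refine mem_of_conn_of_closed (ends := extEnds ends loops) (ω := ω) ?_
      ⟨x, rfl, conn_refl ends (restrict ω) x⟩ h
    rintro v ⟨y, rfl, hy⟩ u huv
    obtain ⟨_, e', he', hends'⟩ := openGraph_adj.1 huv
    rcases e' with e | l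
    · obtain ⟨⟨a, c⟩, hac⟩ := Quot.exists_rep (ends e)
      have hends : ends e = s(a, c) := hac.symm
      rw [extEnds_inl, hends, Sym2.map_mk, Sym2.eq_iff] at hends'
      have hopen : OpenAdj ends (restrict ω) a c := ⟨e, he', hends⟩
      rcases hends' with ⟨hay, hcu⟩ | ⟨hau, hcy⟩
      · refine ⟨c, hcu.symm, conn_trans hy ?_⟩
        rw [← Sum.inl_injective hay]
        exact conn_of_openAdj hopen
      · refine ⟨a, hau.symm, conn_trans hy ?_⟩
        rw [← Sum.inl_injective hcy]
        exact conn_of_openAdj hopen.symm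
    · have hd := hl l
      rw [extEnds_inr] at hends'
      rw [hends', Sym2.mk_isDiag_iff] at hd
      exact ⟨y, hd.symm, hy⟩
  obtain ⟨y, hy, hxy⟩ := key
  rw [Sum.inl_injective hy]
  exact hxy

/-- **The connectivity between vertices of `V` is unchanged** by spare loops and spare isolated
vertices. -/
theorem conn_inl_iff {ends : E → Sym2 V} {loops : L → Sym2 (V ⊕ W)} (hl : ∀ l, (loops l).IsDiag)
    (ω : Config (E ⊕ L)) (x z : V) :
    Conn (extEnds ends loops) ω (Sum.inl x) (Sum.inl z) ↔ Conn ends (restrict ω) x z :=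
  ⟨conn_of_conn_inl hl, conn_inl_of_conn⟩

end Ext

/-! ## The embedding identity -/

section Embed

variable {V W E L : Type*} [Fintype E] [DecidableEq E] [Fintype L] [DecidableEq L] {R : Type*}
  [Field R]

/-- **Spare loops and spare isolated vertices are invisible**: `Gc` of the instance `(p, ends)` on
`(V, E)` is `Gc` of the extended instance `(Sum.elim p r, extEnds ends loops)` on `(V ⊕ W, E ⊕ L)`
at the marks `Sum.inl o, …`, for every weight vector `r` on the spare loops. -/
theorem Gc_embed (p : E → R) (r : L → R) (ends : E → Sym2 V) (loops : L → Sym2 (V ⊕ W))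
    (hl : ∀ l, (loops l).IsDiag) (o a₁ a₂ a₃ b : V) :
    Gc p ends o a₁ a₂ a₃ b =
      Gc (Sum.elim p r) (extEnds ends loops) (Sum.inl o) (Sum.inl a₁) (Sum.inl a₂) (Sum.inl a₃)
        (Sum.inl b) :=
  Gc_transport (Ψ := restrict) (φ := Sum.inl) (fun A => (prob_restrict_preimage p r A).symm)
    o a₁ a₂ a₃ b (fun ω x _ z _ => (conn_inl_iff hl ω x z).symm)

end Embed

end Types

end Summit.Ventures.PercRepro2
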